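import Mathlib
import HarnessLib
import Summits.NavierStokesRegularity.NavierStokesRegularity.Theorems.PoloidalWindowDoorLrcModEntireCurvedTowerKill
import Summits.NavierStokesRegularity.NavierStokesRegularity.Theorems.PoloidalWindowDoorLrcModEntireCurvedTimeSplitLocal
import Summits.NavierStokesRegularity.NavierStokesRegularity.Theorems.PoloidalWindowDoorLrcModEntireQ4LineTools

/-!
# Route `PoloidalWindowDoor`, item `LrcModEntire` (stmt-NavierStokesRegularity-20428) — THE §6 TOWER AT ONE BASE POINT OF A CURVED TIME WEB,
# LITERAL-FREE FORM (TOWER-CLOSES §E; for the v16 NON-VERTICAL child of `stub_Q4curvedAperiodic` as well as case II)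

Cell ns-regularity-ideate, helper seat ns-k2-port-2 g9 under the LEAD of item 20428 (ns-poloidal-K2-p3 g18); `--supports stmt-NavierStokesRegularity-20428 --as helper`.
★★ `curvature_deriv_zero_at_free` — the same theorem as `…CurvedEndKill.curvature_deriv_zero_at` with the two case-II-specific inputs removed: (a) the local
package clause carries NO line-frame conjunct (`… = frameCLM e (S q, n₀ …)`; it was never used), so it is exactly what K2-p2 g18's B-TWP0c `…CurvedTimeWebAt`
produces over a CURVED hot branch at base time `τ₁ = 0`; (b) instead of «`R(τ₁,·)` analytic and not affine + transversal offset on `|z| < ε₂`» it takes ONE open height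
interval `(a, b)` inside the box on which `∂_zG₁(τ₁,σ₀,·) ≠ 0` AND `R_zz(τ₁,·) ≠ 0` (the window need not contain `0`).  Conclusion `k₁′(σ₀) = 0`.  Proof identical
(★★★ `…CurvedTowerKill.tower_kills_curvature` with `d := G₁(τ₁,σ₀,·)`, `κ := σκt(τ₁,·)`, `R_v := σR(τ₁,·)`, `μ` smooth via the slice law, `hkin_of_criticality`,
`curved_webSpeed_split_on` on the time-shifted web).
WHAT THIS IS NOT: not a claim about Navier–Stokes regularity; closes nothing; items 20428 / 19708 / 27893 OPEN (bears_on LADDER-NS N0).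
-/

noncomputable section

set_option linter.dupNamespace false
set_option linter.style.longLine false

namespace Summit.NavierStokesRegularity.NavierStokesRegularity.Theorems.PoloidalWindowDoorLrcModEntireCurvedEndKillFree

open Set Function Filter Topology Metric
open scoped RealInnerProductSpace InnerProductSpace ContDiff Laplacian
open Literature.Analysis Literature.Analysis.FluidPDE Literature.Analysis.UnboundedOperators
open Summit.NavierStokesRegularity.NavierStokesRegularity.Theorems
open Summit.NavierStokesRegularity.NavierStokesRegularity.Theorems.LocalSineTubeDoorProfileAlignedWindowRigidityAncient
open Summit.NavierStokesRegularity.NavierStokesRegularity.Theorems.PoloidalWindowDoorPoloidalWindowRigidityWindow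
open Summit.NavierStokesRegularity.NavierStokesRegularity.Theorems.PoloidalWindowDoorPoloidalWindowRigidityConstantShearSlice
open Summit.NavierStokesRegularity.NavierStokesRegularity.Theorems.PoloidalWindowDoorPoloidalWindowRigidityTimeHeightShearLinearSlice
open Summit.NavierStokesRegularity.NavierStokesRegularity.Theorems.PoloidalWindowDoorLrcModEntireSheetFlattenTools
open Summit.NavierStokesRegularity.NavierStokesRegularity.Theorems.PoloidalWindowDoorLrcModEntireRidgeGlobalBranchODE
open Summit.NavierStokesRegularity.NavierStokesRegularity.Theorems.PoloidalWindowDoorLrcModEntireRidgeGlobalBranchFrame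
open Summit.NavierStokesRegularity.NavierStokesRegularity.Theorems.PoloidalWindowDoorLrcModEntirePlanarCurveRigidity
open Summit.NavierStokesRegularity.NavierStokesRegularity.Theorems.PoloidalWindowDoorLrcModEntireRidgeClassConstants
open Summit.NavierStokesRegularity.NavierStokesRegularity.Theorems.PoloidalWindowDoorLrcModEntireCurvedSheetJetLocal
open Summit.NavierStokesRegularity.NavierStokesRegularity.Theorems.PoloidalWindowDoorLrcModEntireCurvedTowerSheetForm
open Summit.NavierStokesRegularity.NavierStokesRegularity.Theorems.PoloidalWindowDoorLrcModEntireCurvedTowerKill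
open Summit.NavierStokesRegularity.NavierStokesRegularity.Theorems.PoloidalWindowDoorLrcModEntireQ4LineTools
open Summit.NavierStokesRegularity.NavierStokesRegularity.Theorems.PoloidalWindowDoorLrcModEntireCurvedTimeSplitLocal
open Summit.NavierStokesRegularity.NavierStokesRegularity.Theorems.PoloidalWindowDoorLrcModEntireQ4SonicHotSheetSecondPins (fderiv_fderiv_const_mul_apply)

variable {C : ℝ} {U : ℝ → EuclideanSpace ℝ (Fin 3) → EuclideanSpace ℝ (Fin 3)}

/-- **Non-affine analytic ⇒ non-characteristic heights in EVERY sub-interval** `(a′, b′) ⊆ (−δ, δ)` (class-free companion of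
`…PeriodicSheetAtTime.exists_noncharacteristic_window`, whose windows are symmetric about `0`). -/
theorem exists_noncharacteristic_subwindow {g : ℝ → ℝ} {δ a' b' : ℝ} (hab : a' < b') (hsub : Ioo a' b' ⊆ Ioo (-δ) δ)
    (hg : AnalyticOnNhd ℝ g (Ioo (-δ) δ)) (hns : ¬ (∃ a b : ℝ, ∀ z : ℝ, |z| < δ → g z = a + b * z)) :
    ∃ a b : ℝ, a < b ∧ Ioo a b ⊆ Ioo a' b' ∧ ∀ z ∈ Ioo a b, deriv (deriv g) z ≠ 0 := by
  have hz₁ : (a' + b') / 2 ∈ Ioo a' b' := ⟨by linarith, by linarith⟩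
  have hδ : 0 < δ := by have h := hsub hz₁; rw [mem_Ioo] at h; linarith [h.1, h.2]
  have h0S : (0 : ℝ) ∈ Ioo (-δ) δ := ⟨by linarith, hδ⟩
  have hD1 : AnalyticOnNhd ℝ (deriv g) (Ioo (-δ) δ) := hg.deriv
  have hD2 : AnalyticOnNhd ℝ (deriv (deriv g)) (Ioo (-δ) δ) := hD1.deriv
  have hex : ∃ z₀ ∈ Ioo a' b', deriv (deriv g) z₀ ≠ 0 := by
    by_contra hall
    push Not at hall
    have hev : deriv (deriv g) =ᶠ[𝓝 ((a' + b') / 2)] 0 :=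
      Filter.eventuallyEq_of_mem (isOpen_Ioo.mem_nhds hz₁) fun z hz => hall z hz
    have hzero := hD2.eqOn_zero_of_preconnected_of_eventuallyEq_zero isPreconnected_Ioo (hsub hz₁) hev
    have hgd : ∀ z ∈ Ioo (-δ) δ, DifferentiableAt ℝ g z := fun z hz => (hg z hz).differentiableAt
    have hg'd : ∀ z ∈ Ioo (-δ) δ, DifferentiableAt ℝ (deriv g) z := fun z hz => (hD1 z hz).differentiableAt
    have haff := affine_of_deriv_deriv_eq_zero isOpen_Ioo isPreconnected_Ioo hgd hg'd (fun z hz => hzero hz) h0S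
    exact hns ⟨g 0, deriv g 0, fun z hz => by rw [haff z (abs_lt.1 hz |> fun h => ⟨h.1, h.2⟩)]; ring⟩
  obtain ⟨z₀, hz₀, hne⟩ := hex
  have hcont : ContinuousOn (deriv (deriv g)) (Ioo a' b') := hD2.continuousOn.mono hsub
  have hVo : IsOpen (Ioo a' b' ∩ (deriv (deriv g)) ⁻¹' ({0}ᶜ)) := hcont.isOpen_inter_preimage isOpen_Ioo isOpen_compl_singleton
  obtain ⟨a, b, hab', hI⟩ := hVo.exists_Ioo_subset ⟨z₀, hz₀, hne⟩
  exact ⟨a, b, hab', fun z hz => (hI hz).1, fun z hz => (hI hz).2⟩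

/-- ★★ **AT ONE BASE POINT, THE §6 TOWER KILLS THE CURVATURE DERIVATIVE — literal-free form** (local package at `σ₀` without the line-frame conjunct, parallel
webs at `τ₁`, one open height interval `(a, b)` in the box with transversal offset and `R_zz(τ₁,·) ≠ 0`): `k₁′(σ₀) = 0`. -/
theorem curvature_deriv_zero_at_free
    (hrate : HasTypeITimeDecay C U) (hcont : ContinuousOn (uncurry U) (Iio (0 : ℝ) ×ˢ univ))
    (hmild : ∀ s t : ℝ, s < t → t < 0 → ∀ x, U t x = heatExtension (U s) (t - s) x - oseenDuhamel 1 s U U t x)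
    (hdiv : ∀ t < 0, VectorCalculus.IsDivFree (U t))
    (hpol : ∀ s < 0, ∀ y, ⟪curl (U s) y, EuclideanSpace.single 2 1⟫_ℝ = 0)
    {σ ρ : ℝ} {μ : ℝ → ℝ → ℝ} (hμ3 : ContDiff ℝ 3 (uncurry μ))
    (hslabU : ∀ t : ℝ, |t + 1| < ρ → ∀ x : EuclideanSpace ℝ (Fin 3), |x 2| < ρ → ∀ b : Fin 3, b ≠ 2 →
      fderiv ℝ (U t) x (EuclideanSpace.single 2 1) b = μ t (x 2) * fderiv ℝ (U t) x (EuclideanSpace.single b 1) 2)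
    (hσ : σ = 1 ∨ σ = -1)
    {δ' : ℝ} {R κt : ℝ → ℝ → ℝ} (hδ'ρ : δ' ≤ ρ) (hδ'h : δ' < 1 / 2)
    (hκt : ∀ τ z : ℝ, |τ| < δ' → |z| < δ' → 0 < κt τ z)
    (hμ1B : ∀ τ z : ℝ, |τ| < δ' → |z| < δ' → μ (-1 + τ) z < 1)
    {τ₁ : ℝ} (hτ₁ : |τ₁| < δ')
    {Γ : ℝ → EuclideanSpace ℝ (Fin 3)} {k₁ : ℝ → ℝ} (hΓ : ContDiff ℝ ∞ Γ) (hpl : ∀ s, Γ s 2 = 0) (hun : ∀ s, ‖deriv Γ s‖ = 1)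
    (hk₁ : ContDiff ℝ ∞ k₁) (hfrenet : ∀ s, deriv (deriv Γ) s = k₁ s • rotJ (deriv Γ s))
    {σ₀ ε₁ : ℝ} {G₁ : ℝ × ℝ × ℝ → ℝ} (hε₁ : 0 < ε₁)
    (hG : ContDiffOn ℝ ∞ G₁ {q : ℝ × ℝ × ℝ | |q.1 - τ₁| < ε₁ ∧ |q.2.1 - σ₀| < ε₁ ∧ |q.2.2| < ε₁})
    (hq : ∀ q : ℝ × ℝ × ℝ, |q.1 - τ₁| < ε₁ → |q.2.1 - σ₀| < ε₁ → |q.2.2| < ε₁ →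
      |q.1| < δ' ∧ |q.2.2| < δ' ∧ 1 - k₁ q.2.1 * G₁ q ≠ 0 ∧
      fderiv ℝ (fun y => σ * U (-1 + q.1) y 2) (Γ q.2.1 + G₁ q • rotJ (deriv Γ q.2.1) + q.2.2 • e2) (rotJ (deriv Γ q.2.1)) = 0 ∧
      fderiv ℝ (fun y => σ * U (-1 + q.1) y 2) (Γ q.2.1 + G₁ q • rotJ (deriv Γ q.2.1) + q.2.2 • e2) (deriv Γ q.2.1) = 0 ∧
      σ * U (-1 + q.1) (Γ q.2.1 + G₁ q • rotJ (deriv Γ q.2.1) + q.2.2 • e2) 2 = R q.1 q.2.2 ∧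
      fderiv ℝ (fderiv ℝ (fun y => σ * U (-1 + q.1) y 2)) (Γ q.2.1 + G₁ q • rotJ (deriv Γ q.2.1) + q.2.2 • e2) (deriv Γ q.2.1) (deriv Γ q.2.1) +
          fderiv ℝ (fderiv ℝ (fun y => σ * U (-1 + q.1) y 2)) (Γ q.2.1 + G₁ q • rotJ (deriv Γ q.2.1) + q.2.2 • e2)
            (rotJ (deriv Γ q.2.1)) (rotJ (deriv Γ q.2.1)) = -κt q.1 q.2.2 ∧
      fderiv ℝ (fderiv ℝ (fun y => σ * U (-1 + q.1) y 2)) (Γ q.2.1 + G₁ q • rotJ (deriv Γ q.2.1) + q.2.2 • e2) e2 e2 =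
        -μ (-1 + q.1) q.2.2 *
          (fderiv ℝ (fderiv ℝ (fun y => σ * U (-1 + q.1) y 2)) (Γ q.2.1 + G₁ q • rotJ (deriv Γ q.2.1) + q.2.2 • e2) (deriv Γ q.2.1) (deriv Γ q.2.1) +
            fderiv ℝ (fderiv ℝ (fun y => σ * U (-1 + q.1) y 2)) (Γ q.2.1 + G₁ q • rotJ (deriv Γ q.2.1) + q.2.2 • e2)
              (rotJ (deriv Γ q.2.1)) (rotJ (deriv Γ q.2.1))) ∧
      κt q.1 q.2.2 * (1 - k₁ q.2.1 * G₁ q) ^ 2 * (fderiv ℝ G₁ q ((0 : ℝ), (0 : ℝ), (1 : ℝ))) ^ 2 =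
        (deriv (deriv (R q.1)) q.2.2 - μ (-1 + q.1) q.2.2 * κt q.1 q.2.2) *
          ((1 - k₁ q.2.1 * G₁ q) ^ 2 + (fderiv ℝ G₁ q ((0 : ℝ), (1 : ℝ), (0 : ℝ))) ^ 2))
    (hparr : ∀ s s' z : ℝ, |s - σ₀| < ε₁ → |s' - σ₀| < ε₁ → |z| < ε₁ → G₁ (τ₁, s, z) = G₁ (τ₁, s', z))
    {a b : ℝ} (hab : a < b) (hIε₁ : ∀ z ∈ Ioo a b, |z| < ε₁)
    (hwin : ∀ z ∈ Ioo a b, fderiv ℝ G₁ (τ₁, σ₀, z) ((0 : ℝ), (0 : ℝ), (1 : ℝ)) ≠ 0 ∧ deriv (deriv (R τ₁)) z ≠ 0) :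
    deriv k₁ σ₀ = 0 := by
  have hτh : |τ₁| < 1 / 2 := lt_trans hτ₁ hδ'h
  have hτρ : |τ₁| < ρ := lt_of_lt_of_le hτ₁ hδ'ρ
  have ht : -1 + τ₁ < 0 := by linarith [(abs_lt.1 hτh).2]
  have htρ : |(-1 + τ₁) + 1| < ρ := by rw [show (-1 + τ₁) + 1 = τ₁ by ring]; exact hτρ
  have hσ0 : σ ≠ 0 := by rcases hσ with h | h <;> rw [h] <;> norm_num
  have hσ2 : σ * σ = 1 := by rcases hσ with h | h <;> rw [h] <;> norm_num
  have hUan : AnalyticOnNhd ℝ (U (-1 + τ₁)) univ := analyticOnNhd_slice hcont (bdd_of_hasTypeITimeDecay hrate) hmild ht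
  have hUC : ContDiff ℝ ∞ (U (-1 + τ₁)) := hUan.contDiff
  have hU2 : ContDiff ℝ 2 (U (-1 + τ₁)) := hUan.contDiff
  have hθC : ContDiff ℝ ∞ (fun y => U (-1 + τ₁) y 2) :=
    (contDiff_piLp_apply (p := 2) (𝕜 := ℝ) (E := fun _ : Fin 3 => ℝ) (i := (2 : Fin 3))).comp hUC
  have hθ2 : ContDiff ℝ 2 (fun y => U (-1 + τ₁) y 2) := hθC.of_le (by norm_cast)
  have hθd : Differentiable ℝ (fun y => U (-1 + τ₁) y 2) := hθC.differentiable (by simp)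
  have hFC : ContDiff ℝ ∞ (fun y => σ * U (-1 + τ₁) y 2) := contDiff_const.mul hθC
  have hΓ2 : ContDiff ℝ 2 Γ := hΓ.of_le (by norm_cast)
  have hFθ : ∀ x v, fderiv ℝ (fun y => σ * U (-1 + τ₁) y 2) x v = σ * fderiv ℝ (fun y => U (-1 + τ₁) y 2) x v := fun x v => by
    rw [show (fun y => σ * U (-1 + τ₁) y 2) = fun y => σ * (fun y' => U (-1 + τ₁) y' 2) y from rfl, fderiv_const_mul (hθd x) σ]
    simp [smul_eq_mul]
  have hF2 : ∀ x u w, fderiv ℝ (fderiv ℝ (fun y => σ * U (-1 + τ₁) y 2)) x u w = σ * fderiv ℝ (fderiv ℝ (fun y => U (-1 + τ₁) y 2)) x u w :=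
    fun x u w => fderiv_fderiv_const_mul_apply hθ2 σ x u w
  have hIo : IsOpen (Ioo a b) := isOpen_Ioo
  have hRzz : ∀ z ∈ Ioo a b, deriv (deriv (R τ₁)) z ≠ 0 := fun z hz => (hwin z hz).2
  set S : Set ℝ := {s : ℝ | |s - σ₀| < ε₁} with hS_def
  have hSo : IsOpen S := isOpen_lt (continuous_id.sub continuous_const).abs continuous_const
  have hσ₀S : σ₀ ∈ S := by simp [hS_def, hε₁]
  have hτ₁₁ : |τ₁ - τ₁| < ε₁ := by simpa using hε₁
  have hP : ∀ s ∈ S, ∀ z ∈ Ioo a b,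
      |z| < δ' ∧ 1 - k₁ s * G₁ (τ₁, s, z) ≠ 0 ∧
      fderiv ℝ (fun y => σ * U (-1 + τ₁) y 2) (Γ s + G₁ (τ₁, s, z) • rotJ (deriv Γ s) + z • e2) (rotJ (deriv Γ s)) = 0 ∧
      fderiv ℝ (fun y => σ * U (-1 + τ₁) y 2) (Γ s + G₁ (τ₁, s, z) • rotJ (deriv Γ s) + z • e2) (deriv Γ s) = 0 ∧
      σ * U (-1 + τ₁) (Γ s + G₁ (τ₁, s, z) • rotJ (deriv Γ s) + z • e2) 2 = R τ₁ z ∧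
      fderiv ℝ (fderiv ℝ (fun y => σ * U (-1 + τ₁) y 2)) (Γ s + G₁ (τ₁, s, z) • rotJ (deriv Γ s) + z • e2) (deriv Γ s) (deriv Γ s) +
          fderiv ℝ (fderiv ℝ (fun y => σ * U (-1 + τ₁) y 2)) (Γ s + G₁ (τ₁, s, z) • rotJ (deriv Γ s) + z • e2) (rotJ (deriv Γ s)) (rotJ (deriv Γ s)) =
        -κt τ₁ z ∧
      fderiv ℝ (fderiv ℝ (fun y => σ * U (-1 + τ₁) y 2)) (Γ s + G₁ (τ₁, s, z) • rotJ (deriv Γ s) + z • e2) e2 e2 =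
        -μ (-1 + τ₁) z *
          (fderiv ℝ (fderiv ℝ (fun y => σ * U (-1 + τ₁) y 2)) (Γ s + G₁ (τ₁, s, z) • rotJ (deriv Γ s) + z • e2) (deriv Γ s) (deriv Γ s) +
            fderiv ℝ (fderiv ℝ (fun y => σ * U (-1 + τ₁) y 2)) (Γ s + G₁ (τ₁, s, z) • rotJ (deriv Γ s) + z • e2) (rotJ (deriv Γ s)) (rotJ (deriv Γ s))) ∧
      κt τ₁ z * (1 - k₁ s * G₁ (τ₁, s, z)) ^ 2 * (fderiv ℝ G₁ (τ₁, s, z) ((0 : ℝ), (0 : ℝ), (1 : ℝ))) ^ 2 =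
        (deriv (deriv (R τ₁)) z - μ (-1 + τ₁) z * κt τ₁ z) *
          ((1 - k₁ s * G₁ (τ₁, s, z)) ^ 2 + (fderiv ℝ G₁ (τ₁, s, z) ((0 : ℝ), (1 : ℝ), (0 : ℝ))) ^ 2) := by
    intro s hs z hz
    obtain ⟨-, h2, h3, h5, h6, h7, h8, h9, h10⟩ := hq (τ₁, s, z) hτ₁₁ hs (hIε₁ z hz)
    exact ⟨h2, h3, h5, h6, h7, h8, h9, h10⟩
  have hIδ' : ∀ z ∈ Ioo a b, |z| < δ' := fun z hz => (hP σ₀ hσ₀S z hz).1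
  have hIρ : ∀ z ∈ Ioo a b, |z| < ρ := fun z hz => lt_of_lt_of_le (hIδ' z hz) hδ'ρ
  have hκt0 : ∀ z ∈ Ioo a b, 0 < κt τ₁ z := fun z hz => hκt τ₁ z hτ₁ (hIδ' z hz)
  /- STEP 2: the box, `G₁` and its slices; the common offset `d` -/
  have hBo : IsOpen {q : ℝ × ℝ × ℝ | |q.1 - τ₁| < ε₁ ∧ |q.2.1 - σ₀| < ε₁ ∧ |q.2.2| < ε₁} :=
    (isOpen_lt (continuous_fst.sub continuous_const).abs continuous_const).inter
      ((isOpen_lt ((continuous_fst.comp continuous_snd).sub continuous_const).abs continuous_const).inter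
        (isOpen_lt (continuous_snd.comp continuous_snd).abs continuous_const))
  have hGdiff : ∀ q : ℝ × ℝ × ℝ, |q.1 - τ₁| < ε₁ → |q.2.1 - σ₀| < ε₁ → |q.2.2| < ε₁ → DifferentiableAt ℝ G₁ q := fun q h1 h2 h3 =>
    (hG.contDiffAt (hBo.mem_nhds ⟨h1, h2, h3⟩)).differentiableAt (by simp)
  have hG1 : ContDiffOn ℝ ∞ (fun q => fderiv ℝ G₁ q) {q : ℝ × ℝ × ℝ | |q.1 - τ₁| < ε₁ ∧ |q.2.1 - σ₀| < ε₁ ∧ |q.2.2| < ε₁} :=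
    hG.fderiv_of_isOpen hBo (m := ∞) (by simp)
  have hGv : ∀ v : ℝ × ℝ × ℝ, ContDiffOn ℝ ∞ (fun q => fderiv ℝ G₁ q v) {q : ℝ × ℝ × ℝ | |q.1 - τ₁| < ε₁ ∧ |q.2.1 - σ₀| < ε₁ ∧ |q.2.2| < ε₁} :=
    fun v => hG1.clm_apply contDiffOn_const
  have hGvdiff : ∀ v : ℝ × ℝ × ℝ, ∀ q : ℝ × ℝ × ℝ, |q.1 - τ₁| < ε₁ → |q.2.1 - σ₀| < ε₁ → |q.2.2| < ε₁ →
      DifferentiableAt ℝ (fun q => fderiv ℝ G₁ q v) q := fun v q h1 h2 h3 =>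
    ((hGv v).contDiffAt (hBo.mem_nhds ⟨h1, h2, h3⟩)).differentiableAt (by simp)
  have hlz : ∀ s z : ℝ, HasDerivAt (fun z' : ℝ => ((τ₁, s, z') : ℝ × ℝ × ℝ)) ((0 : ℝ), (0 : ℝ), (1 : ℝ)) z := fun s z => by
    have h1 := (hasDerivAt_const z s).prodMk (hasDerivAt_id z)
    simpa using (hasDerivAt_const z τ₁).prodMk h1
  have hls : ∀ s z : ℝ, HasDerivAt (fun s' : ℝ => ((τ₁, s', z) : ℝ × ℝ × ℝ)) ((0 : ℝ), (1 : ℝ), (0 : ℝ)) s := fun s z => by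
    have h1 := (hasDerivAt_id s).prodMk (hasDerivAt_const s z)
    simpa using (hasDerivAt_const s τ₁).prodMk h1
  have hlτ : ∀ s z : ℝ, HasDerivAt (fun τ : ℝ => ((τ, s, z) : ℝ × ℝ × ℝ)) ((1 : ℝ), (0 : ℝ), (0 : ℝ)) τ₁ := fun s z =>
    ((hasDerivAt_id τ₁).prodMk (hasDerivAt_const τ₁ (s, z))).congr_deriv rfl
  obtain ⟨d, hd_def⟩ : ∃ d : ℝ → ℝ, d = fun z' => G₁ (τ₁, σ₀, z') := ⟨_, rfl⟩
  have hdz : ∀ z, G₁ (τ₁, σ₀, z) = d z := fun z => by rw [hd_def]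
  have hdd : ∀ z ∈ Ioo a b, HasDerivAt d (fderiv ℝ G₁ (τ₁, σ₀, z) ((0 : ℝ), (0 : ℝ), (1 : ℝ))) z := fun z hz => by
    rw [hd_def]
    exact (hGdiff (τ₁, σ₀, z) hτ₁₁ hσ₀S (hIε₁ z hz)).hasFDerivAt.comp_hasDerivAt z (hlz σ₀ z)
  have hd_deriv : ∀ z ∈ Ioo a b, deriv d z = fderiv ℝ G₁ (τ₁, σ₀, z) ((0 : ℝ), (0 : ℝ), (1 : ℝ)) := fun z hz => (hdd z hz).deriv
  have hdC : ContDiffOn ℝ ∞ d (Ioo a b) := by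
    rw [hd_def]
    exact hG.comp (contDiffOn_const.prodMk (contDiffOn_const.prodMk contDiffOn_id)) fun z hz => ⟨hτ₁₁, hσ₀S, hIε₁ z hz⟩
  have hddiff : ∀ z ∈ Ioo a b, DifferentiableAt ℝ d z := fun z hz => (hdd z hz).differentiableAt
  have hd0 : ∀ z ∈ Ioo a b, deriv d z ≠ 0 := fun z hz => by rw [hd_deriv z hz]; exact (hwin z hz).1
  have hGd : ∀ s ∈ S, ∀ z ∈ Ioo a b, G₁ (τ₁, s, z) = d z := fun s hs z hz => (hparr s σ₀ z hs hσ₀S (hIε₁ z hz)).trans (hdz z)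
  have hGs : ∀ s ∈ S, ∀ z ∈ Ioo a b, fderiv ℝ G₁ (τ₁, s, z) ((0 : ℝ), (1 : ℝ), (0 : ℝ)) = 0 := by
    intro s hs z hz
    have hc := (hGdiff (τ₁, s, z) hτ₁₁ hs (hIε₁ z hz)).hasFDerivAt.comp_hasDerivAt s (hls s z)
    have hev : (fun s' : ℝ => G₁ (τ₁, s', z)) =ᶠ[𝓝 s] fun _ => d z :=
      Filter.eventuallyEq_of_mem (hSo.mem_nhds hs) fun s' hs' => hGd s' hs' z hz
    have h1 : deriv (fun s' : ℝ => G₁ (τ₁, s', z)) s = fderiv ℝ G₁ (τ₁, s, z) ((0 : ℝ), (1 : ℝ), (0 : ℝ)) := hc.deriv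
    rw [hev.deriv_eq, deriv_const] at h1; exact h1.symm
  /- STEP 3: criticality, Jacobian, value at the sheet points (unsigned currency) -/
  have hν : ∀ s ∈ S, ∀ z ∈ Ioo a b, fderiv ℝ (fun y => U (-1 + τ₁) y 2) (Γ s + d z • rotJ (deriv Γ s) + z • e2) (rotJ (deriv Γ s)) = 0 := by
    intro s hs z hz
    have h := (hP s hs z hz).2.2.1; rw [hGd s hs z hz, hFθ] at h; exact (mul_eq_zero.1 h).resolve_left hσ0
  have hT : ∀ s ∈ S, ∀ z ∈ Ioo a b, fderiv ℝ (fun y => U (-1 + τ₁) y 2) (Γ s + d z • rotJ (deriv Γ s) + z • e2) (deriv Γ s) = 0 := by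
    intro s hs z hz
    have h := (hP s hs z hz).2.2.2.1; rw [hGd s hs z hz, hFθ] at h; exact (mul_eq_zero.1 h).resolve_left hσ0
  have hJ : ∀ s ∈ S, ∀ z ∈ Ioo a b, 1 - k₁ s * d z ≠ 0 := fun s hs z hz => by rw [← hGd s hs z hz]; exact (hP s hs z hz).2.1
  have hval : ∀ s ∈ S, ∀ z ∈ Ioo a b, U (-1 + τ₁) (Γ s + d z • rotJ (deriv Γ s) + z • e2) 2 = σ * R τ₁ z := by
    intro s hs z hz
    have h := (hP s hs z hz).2.2.2.2.1; rw [hGd s hs z hz] at h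
    calc U (-1 + τ₁) (Γ s + d z • rotJ (deriv Γ s) + z • e2) 2 = σ * σ * U (-1 + τ₁) (Γ s + d z • rotJ (deriv Γ s) + z • e2) 2 := by
          rw [hσ2, one_mul]
      _ = σ * R τ₁ z := by rw [mul_assoc, h]
  /- STEP 4: the slice law of the class on the slab `x₂ ∈ I`, the jet identity `D²θ[T,T] = 0`, the ridge curvature `κ = σκt`, the slope -/
  have hμfun : μ (-1 + τ₁) = uncurry μ ∘ fun z : ℝ => (-1 + τ₁, z) := by funext z; rfl
  have hμd : ∀ z ∈ Ioo a b, DifferentiableAt ℝ (μ (-1 + τ₁)) z := fun z _ => by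
    rw [hμfun]; exact ((hμ3.differentiable (by norm_num)) _).comp z ((differentiableAt_const _).prodMk differentiableAt_id)
  have hplane : ∀ z : ℝ, |z| < ρ → ∀ y : EuclideanSpace ℝ (Fin 3), y 2 = z → ∀ b : Fin 3, b ≠ 2 →
      fderiv ℝ (U (-1 + τ₁)) y (EuclideanSpace.single 2 (1 : ℝ)) b = μ (-1 + τ₁) z * fderiv ℝ (U (-1 + τ₁)) y (EuclideanSpace.single b (1 : ℝ)) 2 := by
    intro z hz y hy b hb
    have h := hslabU (-1 + τ₁) htρ y (by rw [hy]; exact hz) b hb; rw [hy] at h; exact h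
  have hlawI : ∀ x : EuclideanSpace ℝ (Fin 3), x 2 ∈ Ioo a b →
      fderiv ℝ (fun y => fderiv ℝ (fun y' => U (-1 + τ₁) y' 2) y (EuclideanSpace.single 2 (1 : ℝ))) x (EuclideanSpace.single 2 (1 : ℝ)) =
        -μ (-1 + τ₁) (x 2) * (fderiv ℝ (fun y => fderiv ℝ (fun y' => U (-1 + τ₁) y' 2) y (EuclideanSpace.single 0 (1 : ℝ))) x (EuclideanSpace.single 0 (1 : ℝ)) +
          fderiv ℝ (fun y => fderiv ℝ (fun y' => U (-1 + τ₁) y' 2) y (EuclideanSpace.single 1 (1 : ℝ))) x (EuclideanSpace.single 1 (1 : ℝ))) :=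
    fun x hx => plane_wave_identity hU2 (fun y => div_coord (hdiv _ ht) y) (hplane (x 2) (hIρ _ hx)) rfl
  have hBTT : ∀ s ∈ S, ∀ z ∈ Ioo a b,
      fderiv ℝ (fderiv ℝ (fun y => U (-1 + τ₁) y 2)) (Γ s + d z • rotJ (deriv Γ s) + z • e2) (deriv Γ s) (deriv Γ s) = 0 :=
    fun s hs z hz => (curved_sheet_jet_on hθC hSo hIo hμd hdC hΓ2 hpl hun hfrenet hJ hlawI hν hT hs hz).2.1
  have hσB : ∀ s ∈ S, ∀ z ∈ Ioo a b,
      σ * fderiv ℝ (fderiv ℝ (fun y => U (-1 + τ₁) y 2)) (Γ s + d z • rotJ (deriv Γ s) + z • e2) (rotJ (deriv Γ s)) (rotJ (deriv Γ s)) = -κt τ₁ z := by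
    intro s hs z hz
    have h := (hP s hs z hz).2.2.2.2.2.1
    rwa [hGd s hs z hz, hF2, hF2, hBTT s hs z hz, mul_zero, zero_add] at h
  have hridge : ∀ s ∈ S, ∀ z ∈ Ioo a b,
      fderiv ℝ (fderiv ℝ (fun y => U (-1 + τ₁) y 2)) (Γ s + d z • rotJ (deriv Γ s) + z • e2) (rotJ (deriv Γ s)) (rotJ (deriv Γ s)) = -(σ * κt τ₁ z) := by
    intro s hs z hz
    have h := hσB s hs z hz
    calc fderiv ℝ (fderiv ℝ (fun y => U (-1 + τ₁) y 2)) (Γ s + d z • rotJ (deriv Γ s) + z • e2) (rotJ (deriv Γ s)) (rotJ (deriv Γ s))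
        = σ * (σ * fderiv ℝ (fderiv ℝ (fun y => U (-1 + τ₁) y 2)) (Γ s + d z • rotJ (deriv Γ s) + z • e2) (rotJ (deriv Γ s)) (rotJ (deriv Γ s))) := by
          rw [← mul_assoc, hσ2, one_mul]
      _ = -(σ * κt τ₁ z) := by rw [h]; ring
  have hκ0 : ∀ z ∈ Ioo a b, σ * κt τ₁ z ≠ 0 := fun z hz => mul_ne_zero hσ0 (hκt0 z hz).ne'
  have hμeq : ∀ s ∈ S, ∀ z ∈ Ioo a b,
      μ (-1 + τ₁) z = fderiv ℝ (fderiv ℝ (fun y => σ * U (-1 + τ₁) y 2)) (Γ s + d z • rotJ (deriv Γ s) + z • e2) e2 e2 / κt τ₁ z := by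
    intro s hs z hz
    have h9 := (hP s hs z hz).2.2.2.2.2.2.1
    have h8 := (hP s hs z hz).2.2.2.2.2.1
    rw [hGd s hs z hz] at h9 h8; rw [h8] at h9; rw [eq_div_iff (hκt0 z hz).ne', h9]; ring
  /- STEP 5: smoothness on `I` of `κ`, `R_v`, `μ(−1+τ₁,·)` through the base sheet line `z ↦ W(σ₀, z)` -/
  have hW₀ : ContDiffOn ℝ ∞ (fun z : ℝ => Γ σ₀ + d z • rotJ (deriv Γ σ₀) + z • e2) (Ioo a b) :=
    (contDiffOn_const.add (hdC.smul contDiffOn_const)).add (contDiffOn_id.smul contDiffOn_const)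
  have hFF : ContDiff ℝ ∞ (fderiv ℝ (fderiv ℝ (fun y => σ * U (-1 + τ₁) y 2))) :=
    (hFC.fderiv_right (m := ∞) (by simp)).fderiv_right (m := ∞) (by simp)
  have hHess : ∀ u w : EuclideanSpace ℝ (Fin 3),
      ContDiffOn ℝ ∞ (fun z : ℝ => fderiv ℝ (fderiv ℝ (fun y => σ * U (-1 + τ₁) y 2)) (Γ σ₀ + d z • rotJ (deriv Γ σ₀) + z • e2) u w) (Ioo a b) :=
    fun u w => ((hFF.comp_contDiffOn hW₀).clm_apply contDiffOn_const).clm_apply contDiffOn_const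
  have hκtC : ContDiffOn ℝ ∞ (fun z => κt τ₁ z) (Ioo a b) := by
    refine ((hHess (deriv Γ σ₀) (deriv Γ σ₀)).add (hHess (rotJ (deriv Γ σ₀)) (rotJ (deriv Γ σ₀)))).neg.congr fun z hz => ?_
    have h8 := (hP σ₀ hσ₀S z hz).2.2.2.2.2.1
    rw [hGd σ₀ hσ₀S z hz] at h8
    linarith
  have hκC : ContDiffOn ℝ ∞ (fun z => σ * κt τ₁ z) (Ioo a b) := contDiffOn_const.mul hκtC
  have hRvC : ContDiffOn ℝ ∞ (fun z => σ * R τ₁ z) (Ioo a b) :=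
    (hθC.comp_contDiffOn hW₀).congr fun z hz => (hval σ₀ hσ₀S z hz).symm
  have hμs : ContDiffOn ℝ ∞ (μ (-1 + τ₁)) (Ioo a b) :=
    ((hHess e2 e2).div hκtC fun z hz => (hκt0 z hz).ne').congr fun z hz => hμeq σ₀ hσ₀S z hz
  have hμ1 : ∀ z ∈ Ioo a b, μ (-1 + τ₁) z ≠ 1 := fun z hz => (hμ1B τ₁ z hτ₁ (hIδ' z hz)).ne
  /- STEP 6: `d′² + μ ≠ 0` on `I` from the Huygens identity and `R_zz(τ₁,·) ≠ 0` -/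
  have hQ : ∀ z ∈ Ioo a b, deriv d z ^ 2 + μ (-1 + τ₁) z ≠ 0 := by
    intro z hz h0
    have hH := (hP σ₀ hσ₀S z hz).2.2.2.2.2.2.2
    rw [hdz z, ← hd_deriv z hz, hGs σ₀ hσ₀S z hz] at hH
    have hJ0 := hJ σ₀ hσ₀S z hz
    have h1 : (κt τ₁ z * (deriv d z ^ 2 + μ (-1 + τ₁) z) - deriv (deriv (R τ₁)) z) * (1 - k₁ σ₀ * d z) ^ 2 = 0 := by
      linear_combination hH
    have h2 := (mul_eq_zero.1 h1).resolve_right (pow_ne_zero 2 hJ0)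
    rw [h0, mul_zero, zero_sub, neg_eq_zero] at h2; exact hRzz z hz h2
  /- STEP 7: the kinematic identity at every sheet point (criticality at all nearby times, `hkin_of_criticality`) -/
  have hF2u : ∀ P₀ : EuclideanSpace ℝ (Fin 3), ContDiffAt ℝ 2 (uncurry fun a y => σ * U (-1 + a) y 2) (τ₁, P₀) := fun P₀ => by
    have h := contDiffOn_uncurry_signed hrate hcont hmild hdiv σ (n := 2) (T := Ioo (-1 / 2) (1 / 2)) Subset.rfl
    exact h.contDiffAt ((isOpen_Ioo.prod isOpen_univ).mem_nhds ⟨⟨by linarith [(abs_lt.1 hτh).1], by linarith [(abs_lt.1 hτh).2]⟩, mem_univ _⟩)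
  have hkin : ∀ s ∈ S, ∀ z ∈ Ioo a b,
      fderiv ℝ (fderiv ℝ (uncurry fun a y => σ * U (-1 + a) y 2)) (τ₁, Γ s + d z • rotJ (deriv Γ s) + z • e2)
        ((1 : ℝ), fderiv ℝ G₁ (τ₁, s, z) ((1 : ℝ), (0 : ℝ), (0 : ℝ)) • rotJ (deriv Γ s)) ((0 : ℝ), rotJ (deriv Γ s)) = 0 := by
    intro s hs z hz
    have hg : HasDerivAt (fun τ : ℝ => G₁ (τ, s, z)) (fderiv ℝ G₁ (τ₁, s, z) ((1 : ℝ), (0 : ℝ), (0 : ℝ))) τ₁ :=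
      (hGdiff (τ₁, s, z) hτ₁₁ hs (hIε₁ z hz)).hasFDerivAt.comp_hasDerivAt τ₁ (hlτ s z)
    have hPd : HasDerivAt (fun τ : ℝ => Γ s + G₁ (τ, s, z) • rotJ (deriv Γ s) + z • e2)
        (fderiv ℝ G₁ (τ₁, s, z) ((1 : ℝ), (0 : ℝ), (0 : ℝ)) • rotJ (deriv Γ s)) τ₁ :=
      ((hg.smul_const (rotJ (deriv Γ s))).const_add (Γ s)).add_const (z • e2)
    have hP0 : (fun τ : ℝ => Γ s + G₁ (τ, s, z) • rotJ (deriv Γ s) + z • e2) τ₁ = Γ s + d z • rotJ (deriv Γ s) + z • e2 := by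
      simp only [hGd s hs z hz]
    have hcrit : ∀ᶠ τ in 𝓝 τ₁, fderiv ℝ (fun y => (uncurry fun a y => σ * U (-1 + a) y 2) (τ, y))
        ((fun τ : ℝ => Γ s + G₁ (τ, s, z) • rotJ (deriv Γ s) + z • e2) τ) (rotJ (deriv Γ s)) = 0 := by
      have hmem : {τ : ℝ | |τ - τ₁| < ε₁} ∈ 𝓝 τ₁ := (isOpen_lt (continuous_id.sub continuous_const).abs continuous_const).mem_nhds (by simpa using hε₁)
      filter_upwards [hmem] with τ hτ
      exact (hq (τ, s, z) hτ hs (hIε₁ z hz)).2.2.2.1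
    exact hkin_of_criticality (hF2u _) hP0 hPd hcrit
  /- STEP 8: the additive split of `V = ∂_τ G₁ (τ₁, ·, ·)` (the time-shifted web and `curved_webSpeed_split_on`) -/
  obtain ⟨zc, hzc⟩ : (Ioo a b).Nonempty := nonempty_Ioo.2 hab
  have hOo : IsOpen {q : ℝ × ℝ × ℝ | |q.1| < ε₁ ∧ |q.2.1 - σ₀| < ε₁ ∧ |q.2.2| < ε₁} :=
    (isOpen_lt continuous_fst.abs continuous_const).inter
      ((isOpen_lt ((continuous_fst.comp continuous_snd).sub continuous_const).abs continuous_const).inter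
        (isOpen_lt (continuous_snd.comp continuous_snd).abs continuous_const))
  have hshτ : ∀ τ : ℝ, |τ| < ε₁ → |τ₁ + τ - τ₁| < ε₁ := fun τ hτ => by rw [add_sub_cancel_left]; exact hτ
  have hGsh : ContDiffOn ℝ 2 (fun q : ℝ × ℝ × ℝ => G₁ (τ₁ + q.1, q.2)) {q : ℝ × ℝ × ℝ | |q.1| < ε₁ ∧ |q.2.1 - σ₀| < ε₁ ∧ |q.2.2| < ε₁} := by
    have hA : ContDiff ℝ ∞ (fun q : ℝ × ℝ × ℝ => ((τ₁ + q.1, q.2) : ℝ × ℝ × ℝ)) := (contDiff_const.add contDiff_fst).prodMk contDiff_snd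
    exact (hG.comp hA.contDiffOn fun q hq' => ⟨hshτ q.1 hq'.1, hq'.2.1, hq'.2.2⟩).of_le (by norm_cast)
  have hfdsh : ∀ τ s z : ℝ, |τ| < ε₁ → |s - σ₀| < ε₁ → |z| < ε₁ → ∀ v : ℝ × ℝ × ℝ,
      fderiv ℝ (fun q : ℝ × ℝ × ℝ => G₁ (τ₁ + q.1, q.2)) (τ, s, z) v = fderiv ℝ G₁ (τ₁ + τ, s, z) v := by
    intro τ s z hτ hs hz v
    have hA : HasFDerivAt (fun q : ℝ × ℝ × ℝ => ((τ₁ + q.1, q.2) : ℝ × ℝ × ℝ))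
        (((0 : ℝ × ℝ × ℝ →L[ℝ] ℝ) + ContinuousLinearMap.fst ℝ ℝ (ℝ × ℝ)).prod (ContinuousLinearMap.snd ℝ ℝ (ℝ × ℝ))) (τ, s, z) :=
      ((hasFDerivAt_const τ₁ (τ, s, z)).add hasFDerivAt_fst).prodMk hasFDerivAt_snd
    have hGat : DifferentiableAt ℝ G₁ (τ₁ + τ, s, z) := hGdiff (τ₁ + τ, s, z) (hshτ τ hτ) hs hz
    have hc : HasFDerivAt (fun q : ℝ × ℝ × ℝ => G₁ (τ₁ + q.1, q.2))
        ((fderiv ℝ G₁ (τ₁ + τ, s, z)).comp (((0 : ℝ × ℝ × ℝ →L[ℝ] ℝ) + ContinuousLinearMap.fst ℝ ℝ (ℝ × ℝ)).prod (ContinuousLinearMap.snd ℝ ℝ (ℝ × ℝ))))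
        (τ, s, z) := hGat.hasFDerivAt.comp (τ, s, z) hA
    rw [hc.fderiv]
    simp
  have hpinsh : ∀ s ∈ S, ∀ z ∈ Ioo a b, (fun q : ℝ × ℝ × ℝ => G₁ (τ₁ + q.1, q.2)) (0, s, z) = d z := by
    intro s hs z hz; simp only [add_zero]; exact hGd s hs z hz
  have hsO : ∀ s ∈ S, ∀ z ∈ Ioo a b, ((0 : ℝ), s, z) ∈ {q : ℝ × ℝ × ℝ | |q.1| < ε₁ ∧ |q.2.1 - σ₀| < ε₁ ∧ |q.2.2| < ε₁} :=
    fun s hs z hz => ⟨by simpa using hε₁, hs, hIε₁ z hz⟩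
  -- `Ψ(τ, z) := (J²G_z²/(J² + G_s²))(τ₁+τ, σ₀, z)` (`= (R_zz − μκt)/κt` by the Huygens identity)
  obtain ⟨Ψ, hΨ⟩ : ∃ Ψ : ℝ → ℝ → ℝ, Ψ = fun τ z =>
      (1 - k₁ σ₀ * G₁ (τ₁ + τ, σ₀, z)) ^ 2 * (fderiv ℝ G₁ (τ₁ + τ, σ₀, z) ((0 : ℝ), (0 : ℝ), (1 : ℝ))) ^ 2 /
        ((1 - k₁ σ₀ * G₁ (τ₁ + τ, σ₀, z)) ^ 2 + (fderiv ℝ G₁ (τ₁ + τ, σ₀, z) ((0 : ℝ), (1 : ℝ), (0 : ℝ))) ^ 2) := ⟨_, rfl⟩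
  have hHsh : ∀ q ∈ {q : ℝ × ℝ × ℝ | |q.1| < ε₁ ∧ |q.2.1 - σ₀| < ε₁ ∧ |q.2.2| < ε₁},
      (fun _ _ : ℝ => (1 : ℝ)) q.1 q.2.2 * (1 - k₁ q.2.1 * (fun q : ℝ × ℝ × ℝ => G₁ (τ₁ + q.1, q.2)) q) ^ 2 *
          (fderiv ℝ (fun q : ℝ × ℝ × ℝ => G₁ (τ₁ + q.1, q.2)) q ((0 : ℝ), (0 : ℝ), (1 : ℝ))) ^ 2 =
        (Ψ q.1 q.2.2 - (fun _ _ : ℝ => (0 : ℝ)) q.1 q.2.2 * (fun _ _ : ℝ => (1 : ℝ)) q.1 q.2.2) *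
          ((1 - k₁ q.2.1 * (fun q : ℝ × ℝ × ℝ => G₁ (τ₁ + q.1, q.2)) q) ^ 2 +
            (fderiv ℝ (fun q : ℝ × ℝ × ℝ => G₁ (τ₁ + q.1, q.2)) q ((0 : ℝ), (1 : ℝ), (0 : ℝ))) ^ 2) := by
    rintro ⟨τ, s, z⟩ ⟨h1, h2, h3⟩
    dsimp only at h1 h2 h3 ⊢
    rw [hfdsh τ s z h1 h2 h3, hfdsh τ s z h1 h2 h3, hΨ]
    simp only [one_mul, zero_mul, sub_zero]
    obtain ⟨hτδ, hzδ, hJX, -, -, -, -, -, hHX⟩ := hq (τ₁ + τ, s, z) (hshτ τ h1) h2 h3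
    obtain ⟨-, -, hJ0', -, -, -, -, -, hH0⟩ := hq (τ₁ + τ, σ₀, z) (hshτ τ h1) (show σ₀ ∈ S from hσ₀S) h3
    dsimp only at hτδ hzδ hJX hHX hJ0' hH0
    have hκ₀ : 0 < κt (τ₁ + τ) z := hκt _ _ hτδ hzδ
    have hden : (1 - k₁ σ₀ * G₁ (τ₁ + τ, σ₀, z)) ^ 2 + (fderiv ℝ G₁ (τ₁ + τ, σ₀, z) ((0 : ℝ), (1 : ℝ), (0 : ℝ))) ^ 2 ≠ 0 :=
      (add_pos_of_pos_of_nonneg (by positivity) (sq_nonneg _)).ne'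
    rw [div_mul_eq_mul_div, eq_div_iff hden]
    apply mul_left_cancel₀ hκ₀.ne'
    linear_combination ((1 - k₁ σ₀ * G₁ (τ₁ + τ, σ₀, z)) ^ 2 + (fderiv ℝ G₁ (τ₁ + τ, σ₀, z) ((0 : ℝ), (1 : ℝ), (0 : ℝ))) ^ 2) * hHX -
      ((1 - k₁ s * G₁ (τ₁ + τ, s, z)) ^ 2 + (fderiv ℝ G₁ (τ₁ + τ, s, z) ((0 : ℝ), (1 : ℝ), (0 : ℝ))) ^ 2) * hH0
  have hΨd : ∀ z ∈ Ioo a b, DifferentiableAt ℝ (fun τ => Ψ τ z) 0 := by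
    intro z hz
    rw [hΨ]
    have hι : DifferentiableAt ℝ (fun τ : ℝ => ((τ₁ + τ, σ₀, z) : ℝ × ℝ × ℝ)) 0 :=
      ((differentiableAt_const _).add differentiableAt_id).prodMk (differentiableAt_const _)
    have h00 : |τ₁ + 0 - τ₁| < ε₁ := hshτ 0 (by simpa using hε₁)
    have hg : DifferentiableAt ℝ (fun τ : ℝ => G₁ (τ₁ + τ, σ₀, z)) 0 := (hGdiff (τ₁ + 0, σ₀, z) h00 hσ₀S (hIε₁ z hz)).comp (0 : ℝ) hι
    have hgv : ∀ v : ℝ × ℝ × ℝ, DifferentiableAt ℝ (fun τ : ℝ => fderiv ℝ G₁ (τ₁ + τ, σ₀, z) v) 0 := fun v => by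
      have h : DifferentiableAt ℝ ((fun q : ℝ × ℝ × ℝ => fderiv ℝ G₁ q v) ∘ fun τ : ℝ => ((τ₁ + τ, σ₀, z) : ℝ × ℝ × ℝ)) 0 :=
        (hGvdiff v (τ₁ + 0, σ₀, z) h00 hσ₀S (hIε₁ z hz)).comp (0 : ℝ) hι
      exact h
    have hJd : DifferentiableAt ℝ (fun τ : ℝ => (1 - k₁ σ₀ * G₁ (τ₁ + τ, σ₀, z)) ^ 2) 0 := ((differentiableAt_const _).sub ((differentiableAt_const _).mul hg)).pow 2
    refine (hJd.mul ((hgv _).pow 2)).div (hJd.add ((hgv _).pow 2)) ?_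
    have hJ0 := hJ σ₀ hσ₀S z hz
    rw [← hGd σ₀ hσ₀S z hz] at hJ0
    simp only [add_zero]
    exact (add_pos_of_pos_of_nonneg (by positivity) (sq_nonneg _)).ne'
  have hsplit : ∀ s ∈ S, ∀ z ∈ Ioo a b, fderiv ℝ G₁ (τ₁, s, z) ((1 : ℝ), (0 : ℝ), (0 : ℝ)) =
      (fderiv ℝ G₁ (τ₁, s, zc) ((1 : ℝ), (0 : ℝ), (0 : ℝ)) - fderiv ℝ G₁ (τ₁, σ₀, zc) ((1 : ℝ), (0 : ℝ), (0 : ℝ))) +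
        fderiv ℝ G₁ (τ₁, σ₀, z) ((1 : ℝ), (0 : ℝ), (0 : ℝ)) := by
    intro s hs z hz
    have key := curved_webSpeed_split_on (G := fun q : ℝ × ℝ × ℝ => G₁ (τ₁ + q.1, q.2)) (k := k₁) (κ := fun _ _ : ℝ => (1 : ℝ)) (μ := fun _ _ : ℝ => (0 : ℝ))
      (R2 := Ψ) hOo hGsh hSo (rfl : Ioo a b = Ioo a b) hpinsh hddiff hHsh (fun _ _ => one_ne_zero) hd0 (fun _ _ => differentiableAt_const _) hΨd
      (fun _ _ => differentiableAt_const _) hs hσ₀S (hsO s hs) (hsO σ₀ hσ₀S) (hJ s hs) (hJ σ₀ hσ₀S) hz hzc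
    have h0 : |(0 : ℝ)| < ε₁ := by simpa using hε₁
    rw [hfdsh 0 s z h0 hs (hIε₁ z hz), hfdsh 0 σ₀ z h0 hσ₀S (hIε₁ z hz), hfdsh 0 s zc h0 hs (hIε₁ zc hzc), hfdsh 0 σ₀ zc h0 hσ₀S (hIε₁ zc hzc)] at key
    simp only [add_zero] at key
    linarith
  have hα : ContDiffOn ℝ 2 (fun s => fderiv ℝ G₁ (τ₁, s, zc) ((1 : ℝ), (0 : ℝ), (0 : ℝ)) - fderiv ℝ G₁ (τ₁, σ₀, zc) ((1 : ℝ), (0 : ℝ), (0 : ℝ))) S := by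
    have h : ContDiffOn ℝ ∞ (fun s => fderiv ℝ G₁ (τ₁, s, zc) ((1 : ℝ), (0 : ℝ), (0 : ℝ))) S :=
      (hGv ((1 : ℝ), (0 : ℝ), (0 : ℝ))).comp (contDiffOn_const.prodMk (contDiffOn_id.prodMk contDiffOn_const)) fun s hs => ⟨hτ₁₁, hs, hIε₁ zc hzc⟩
    exact (h.of_le (by norm_cast)).sub contDiffOn_const
  have hβ : ContDiffOn ℝ ∞ (fun z => fderiv ℝ G₁ (τ₁, σ₀, z) ((1 : ℝ), (0 : ℝ), (0 : ℝ))) (Ioo a b) :=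
    (hGv ((1 : ℝ), (0 : ℝ), (0 : ℝ))).comp (contDiffOn_const.prodMk (contDiffOn_const.prodMk contDiffOn_id)) fun z hz => ⟨hτ₁₁, hσ₀S, hIε₁ z hz⟩
  exact tower_kills_curvature (τ := τ₁) (S := S) (I := Ioo a b) (s₀ := σ₀) (d := d) (k := k₁) (κ := fun z => σ * κt τ₁ z) (Rv := fun z => σ * R τ₁ z)
    (V := fun s z => fderiv ℝ G₁ (τ₁, s, z) ((1 : ℝ), (0 : ℝ), (0 : ℝ)))
    (α := fun s => fderiv ℝ G₁ (τ₁, s, zc) ((1 : ℝ), (0 : ℝ), (0 : ℝ)) - fderiv ℝ G₁ (τ₁, σ₀, zc) ((1 : ℝ), (0 : ℝ), (0 : ℝ)))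
    (β := fun z => fderiv ℝ G₁ (τ₁, σ₀, z) ((1 : ℝ), (0 : ℝ), (0 : ℝ))) (σ := σ)
    hrate hcont hmild hdiv hpol hμ3 hslabU hτh hτρ hΓ hpl hun hfrenet (hk₁.of_le (by norm_cast)) hSo hσ₀S hIo ⟨zc, hzc⟩ hIρ hdC hd0 hJ hν hT
    hκC hκ0 hridge hRvC hval hσ hkin hsplit hα hβ hQ hμ1 hμs

end Summit.NavierStokesRegularity.NavierStokesRegularity.Theorems.PoloidalWindowDoorLrcModEntireCurvedEndKillFree

end
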